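import Literature.Probability.Percolation.KhSThreeDisorderObservable
import HarnessLib

/-!
# The three-disorder observable: `H₁ + H₂ + H₃ = 1` (the three link patterns partition the loop configurations)

Topic `Literature/Probability/Percolation`; lane pcv-sawmu (CriticalPhenomena), door D1 (three disorders, loop form). Khristoforov–Smirnov,
§2 (arXiv v1 pp. 3–4): «There are three possible link patterns for a loop configuration with disorders at `u₁, u₂, u₃, z`. If `z` is connected
to `u_j` … we say that the event `[z ↔ u_j]` occurs», and Definition 3: `H_j(z) = P^loop_{Ω,u₁,u₂,u₃,z}[z ↔ u_j]`. In the tree's typing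
(`KhSThreeDisorderObservable.lean`: the XOR space `TXb D v i s` at the `i`-th side of a face `v`, odd endpoint `s ∈ {v, oppFace v i}` —
the two halves of the subdivided edge —, classes `InClassX`, counts `classCount D v i j = N_j(z)`, `Hobs D v i j = N_j(z) / 2^{#G}`) this
file proves, for every `k`-marked domain with `k` odd and every face `v` whose three sides are bonds of `H_G`:

* `card_TXb_add_card_TXb`: **`#W(v-half) + #W(opp-half) = 2 ^ #G`** — the configurations with disorders at the `k` corners and at the
  mid-edge `z` number `2^{#G}` (both halves together): split `{ξ ⊆ H_G : odd faces = corners ∪ {v}}` (cardinality `2^{#G}` by the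
  generic parity count `card_filter_parity_eq` of `MarkedLoopSpace.lean`) according to whether the bond dual to `z` is used; erasing it
  toggles the parities of exactly the two faces of the edge (`odd_xiDeg_side_iff`);
* `existsUnique_inClassX`: **every configuration has exactly one link pattern** `[z ↔ u_j]` (HT1 `hbK_exists_unique` + the class
  structure `hbK_complClass_existsUnique` of the parent file), hence `sum_card_filter_inClassX`: `Σ_j N_j = #W` on each half;
* for three marks: `sum_classCount_eq` (`Σ_j N_j(z) = 2^{#G}`), ★ `sum_hobs_eq_one` (**`H₁(z) + H₂(z) + H₃(z) = 1`**), `hobs_nonneg`,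
  `hobs_le_one` — `(H₁, H₂, H₃)(z)` is a probability vector — and the barycentric form `fobs_eq_barycentric`:
  `F(z) − c = Σ_j H_j(z) (τ^j − c)` for every `c` (so `F(z)` is a convex combination of `1, τ, τ²`).

Scope: printed as part of a definition (the uniform measure on `W_Ω(u₁,u₂,u₃,z)` and its three link events); formalised for the edges at
faces with three `H_G`-sides (the standing hypothesis of Lemma 4), which is where the parent file's core bijection HT1 is available.

## References
* M. Khristoforov, S. Smirnov, *Percolation and O(1) loop model*, arXiv:2111.15612 (2021), §1.2 (loop configurations, pp. 2–3), §2
  (the three link patterns pp. 3–4, Fig. 2; Definition 3 p. 4) — arXiv v1 pages.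
-/

open Finset

namespace Literature.Probability.Percolation.MarkedLoops

open Literature.Probability.Percolation Literature.Probability.LatticeModels
open Literature.Probability.Percolation.FivePoint (Inc inc_side side side_injective xiDeg XiLinked tau)
open Literature.Probability.Percolation.FivePoint.N5 (side_oppFace_oppIdx xorDeg_holds l1_odd_xiDeg_singleton_iff h1_ne_oppFace
  coreCompl coreEnd)
open TriMarkedDomain

section Count

variable {nm : ℕ} (D : TriMarkedDomain nm)

/-- erasing a member is the symmetric difference with the singleton. [folklore] -/
private theorem erase_eq_symmDiff' {b : Sym2 (Site 2)} {ξ : Finset (Sym2 (Site 2))} (h : b ∈ ξ) : ξ.erase b = symmDiff ξ {b} := by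
  ext e
  rw [Finset.mem_erase, Finset.mem_symmDiff, Finset.mem_singleton]
  constructor
  · rintro ⟨hne, he⟩; exact Or.inl ⟨he, hne⟩
  · rintro (⟨he, hne⟩ | ⟨rfl, hn⟩)
    · exact ⟨hne, he⟩
    · exact absurd h hn

/-- inserting a non-member is the symmetric difference with the singleton. [folklore] -/
private theorem insert_eq_symmDiff' {b : Sym2 (Site 2)} {ξ : Finset (Sym2 (Site 2))} (h : b ∉ ξ) : insert b ξ = symmDiff ξ {b} := by
  ext e
  rw [Finset.mem_insert, Finset.mem_symmDiff, Finset.mem_singleton]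
  constructor
  · rintro (rfl | he)
    · exact Or.inr ⟨rfl, h⟩
    · exact Or.inl ⟨he, fun e' => h (e' ▸ he)⟩
  · rintro (⟨he, -⟩ | ⟨rfl, -⟩)
    · exact Or.inr he
    · exact Or.inl rfl

/-- **the two faces of an `H_G`-bond**: a touching face has odd `{side v i}`-count iff it is `v` or the opposite face `oppFace v i`.
[cite: KhristoforovSmirnov2021, §1.2 (loop configurations, arXiv v1 pp. 2–3)] -/
theorem odd_xiDeg_side_iff {v F : HexVertex} {i : Fin 3} (hb : side v i ∈ hBonds D) (hF : F ∈ triFacesTouching D.verts) :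
    Odd (xiDeg {side v i} F) ↔ (F = v ∨ F = oppFace v i) := by
  rw [l1_odd_xiDeg_singleton_iff]
  constructor
  · rintro ⟨j, hj⟩
    have hvT : v ∈ triFacesTouching D.verts := mem_touching_of_side_mem D hb
    have hb' : side (oppFace v i) (oppIdx v i) ∈ hBonds D := by rw [side_oppFace_oppIdx]; exact hb
    have hoT : oppFace v i ∈ triFacesTouching D.verts := mem_touching_of_side_mem D hb'
    have iO : Inc (oppFace v i) (side v i) := by rw [← side_oppFace_oppIdx]; exact inc_side _ _
    have iF : Inc F (side v i) := by rw [← hj]; exact inc_side F j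
    exact eq_or_eq_of_inc_three D hb hvT hoT hF (inc_side v i) iO iF (h1_ne_oppFace v i)
  · rintro (rfl | rfl)
    · exact ⟨i, rfl⟩
    · exact ⟨oppIdx _ i, side_oppFace_oppIdx _ i⟩

/-- ★ **`#W_Ω(u₁,…,u_k,z) = 2 ^ #G`** at the `i`-th side of a face with three `H_G`-sides (`k` odd), the two halves of the subdivided edge
counted together: `#TXb D v i v + #TXb D v i (oppFace v i) = 2 ^ #G`. [cite: KhristoforovSmirnov2021, §1.2 (loop configurations, arXiv v1 pp. 2–3) and §2 Definition 3 (p. 4)] -/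
theorem card_TXb_add_card_TXb (hodd : Odd nm) {v : HexVertex} (hv : AllSides D v) (i : Fin 3) :
    #(TXb D v i v) + #(TXb D v i (oppFace v i)) = 2 ^ #D.verts := by
  classical
  have hb : side v i ∈ hBonds D := hv i
  have hvT : v ∈ triFacesTouching D.verts := mem_touching_of_side_mem D hb
  have hvc : v ∉ corners D := fun h => by
    obtain ⟨a, ha⟩ := (mem_corners D).1 h
    exact hbK_yc_ne_v hv a ha.symm
  have hvo : v ≠ oppFace v i := h1_ne_oppFace v i
  -- the even odd-set `O = corners ∪ {v}`
  set O : Finset HexVertex := insert v (corners D) with hO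
  have hOsub : O ⊆ triFacesTouching D.verts := by
    intro F hF
    rcases Finset.mem_insert.1 hF with rfl | hF
    · exact hvT
    · obtain ⟨a, rfl⟩ := (mem_corners D).1 hF
      exact yc_mem_touching D a
  have hcardc : #(corners D) = nm := by
    unfold corners
    rw [Finset.card_image_of_injective _ (yc_injective D), Finset.card_univ, Fintype.card_fin]
  have hOeven : Even #O := by
    rw [hO, Finset.card_insert_of_notMem hvc, hcardc]
    exact hodd.add_one
  have hcount := card_filter_parity_eq D hOsub hOeven
  -- the two parity profiles, read against `O`
  have hPv : ∀ F, F ∈ symmDiff (corners D) ({v} : Finset HexVertex) ↔ F ∈ O := by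
    intro F
    rw [Finset.mem_symmDiff, Finset.mem_singleton, hO, Finset.mem_insert]
    constructor
    · rintro (⟨h, -⟩ | ⟨rfl, -⟩)
      · exact Or.inr h
      · exact Or.inl rfl
    · rintro (rfl | h)
      · exact Or.inr ⟨rfl, hvc⟩
      · exact Or.inl ⟨h, fun e => hvc (e ▸ h)⟩
  have hPo : ∀ F, F ∈ symmDiff (corners D) ({oppFace v i} : Finset HexVertex) ↔ ¬ (F ∈ O ↔ (F = v ∨ F = oppFace v i)) := by
    intro F
    rw [Finset.mem_symmDiff, Finset.mem_singleton, hO, Finset.mem_insert]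
    by_cases h1 : F = v
    · subst h1
      constructor
      · rintro (⟨h, -⟩ | ⟨h, -⟩)
        · exact absurd h hvc
        · exact absurd h hvo
      · intro h; exact absurd (iff_of_true (Or.inl rfl) (Or.inl rfl)) h
    · by_cases h2 : F = oppFace v i
      · constructor
        · rintro (⟨-, hn⟩ | ⟨-, hn⟩)
          · exact absurd h2 hn
          · intro h; exact hn ((h.2 (Or.inr h2)).resolve_left h1)
        · intro h
          exact Or.inr ⟨h2, fun hc => h (iff_of_true (Or.inr hc) (Or.inr h2))⟩
      · constructor
        · rintro (⟨hc, -⟩ | ⟨h, -⟩)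
          · intro h; rcases h.1 (Or.inr hc) with e | e <;> [exact h1 e; exact h2 e]
          · exact absurd h h2
        · intro h
          have hc : F ∈ corners D := by
            by_contra hn
            exact h ⟨fun h' => by rcases h' with e | e <;> [exact absurd e h1; exact absurd e hn], fun h' => by
              rcases h' with e | e <;> [exact absurd e h1; exact absurd e h2]⟩
          exact Or.inl ⟨hc, h2⟩
  set S := (hBonds D).powerset.filter fun ξ => ∀ F ∈ triFacesTouching D.verts, (Odd (xiDeg ξ F) ↔ F ∈ O) with hS
  have htoggle : ∀ (B : Finset (Sym2 (Site 2))) (F : HexVertex), F ∈ triFacesTouching D.verts →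
      (Odd (xiDeg (symmDiff B {side v i}) F) ↔ ¬ (Odd (xiDeg B F) ↔ (F = v ∨ F = oppFace v i))) := by
    intro B F hF
    rw [xorDeg_holds B {side v i} F, odd_xiDeg_side_iff D hb hF]
  -- the half avoiding the bond is the `v`-half
  have hS0 : S.filter (fun ξ => side v i ∉ ξ) = TXb D v i v := by
    ext ξ
    rw [Finset.mem_filter, hS, Finset.mem_filter, Finset.mem_powerset, mem_TXb_iff]
    unfold ParityIs
    constructor
    · rintro ⟨⟨hsub, hpar⟩, hb'⟩
      refine ⟨fun e he' => Finset.mem_erase.2 ⟨fun h => hb' (h ▸ he'), hsub he'⟩, fun F hF => ?_⟩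
      rw [hpar F hF, hPv]
    · rintro ⟨hsub, hpar⟩
      refine ⟨⟨fun e he' => (Finset.mem_erase.1 (hsub he')).2, fun F hF => ?_⟩, fun hb' => (Finset.mem_erase.1 (hsub hb')).1 rfl⟩
      rw [hpar F hF, hPv]
  -- the half using the bond is, after erasing it, the `oppFace v i`-half
  have hS1 : #(S.filter (fun ξ => side v i ∈ ξ)) = #(TXb D v i (oppFace v i)) := by
    refine Finset.card_bij (fun ξ _ => ξ.erase (side v i)) (fun ξ hξ => ?_) (fun ξ hξ ξ' hξ' h => ?_) (fun ζ hζ => ?_)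
    · obtain ⟨hξS, hb'⟩ := Finset.mem_filter.1 hξ
      rw [hS, Finset.mem_filter, Finset.mem_powerset] at hξS
      obtain ⟨hsub, hpar⟩ := hξS
      rw [mem_TXb_iff]
      refine ⟨Finset.erase_subset_erase _ hsub, fun F hF => ?_⟩
      rw [erase_eq_symmDiff' hb', htoggle ξ F hF, hpar F hF, hPo]
    · have hb1 : side v i ∈ ξ := (Finset.mem_filter.1 hξ).2
      have hb2 : side v i ∈ ξ' := (Finset.mem_filter.1 hξ').2
      rw [← Finset.insert_erase hb1, ← Finset.insert_erase hb2, h]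
    · obtain ⟨hsub, hpar⟩ := (mem_TXb_iff v i (oppFace v i) ζ).1 hζ
      have hb_not : side v i ∉ ζ := fun h => (Finset.mem_erase.1 (hsub h)).1 rfl
      refine ⟨insert (side v i) ζ, Finset.mem_filter.2 ⟨?_, Finset.mem_insert_self _ _⟩, Finset.erase_insert hb_not⟩
      rw [hS, Finset.mem_filter, Finset.mem_powerset]
      refine ⟨Finset.insert_subset hb fun e he' => (Finset.mem_erase.1 (hsub he')).2, fun F hF => ?_⟩
      rw [insert_eq_symmDiff' hb_not, htoggle ζ F hF, hpar F hF, hPo]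
      tauto
  rw [← hS0, ← hS1, add_comm, Finset.card_filter_add_card_filter_not]
  exact hcount

/-- ★ **every configuration has exactly one link pattern**: in the XOR space at the `i`-th side of `v` (odd endpoint `s ∈ {v, oppFace v i}`)
the strand from `s` ends at exactly one corner `y_j` — the class `[z ↔ u_j]` is well defined and the classes partition `W`.
[cite: KhristoforovSmirnov2021, §2 (the three link patterns, arXiv v1 pp. 3–4, Fig. 2) and Definition 3 (p. 4)] -/
theorem existsUnique_inClassX {v : HexVertex} (hv : AllSides D v) (i : Fin 3) {s : HexVertex}
    (hs : s ∈ ({v, oppFace v i} : Finset HexVertex)) {ξ : Finset (Sym2 (Site 2))} (hξ : ξ ∈ TXb D v i s) :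
    ∃! j : Fin nm, InClassX D (faceVertex v (i + 1)) (faceVertex v (i + 2)) s j ξ := by
  obtain ⟨⟨S, ζ⟩, ⟨hq, hend, hcompl⟩, -⟩ := hbK_exists_unique hv i hs hξ
  have h := hbK_complClass_existsUnique hv hq i
  unfold ComplClassX at h
  simp only at hend hcompl
  rw [hend, hcompl] at h
  exact h

open Classical in
/-- a set partitioned by `∃!`-classes: its cardinality is the sum of the class cardinalities. [folklore] -/
private theorem card_eq_sum_card_classes' {α β : Type*} [Fintype β] (S : Finset α) (P : β → α → Prop)
    (h : ∀ a ∈ S, ∃! b : β, P b a) : #S = ∑ b, #(S.filter fun a => P b a) := by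
  simp only [Finset.card_filter]
  rw [Finset.sum_comm]
  rw [Finset.card_eq_sum_ones]
  refine Finset.sum_congr rfl fun a ha => ?_
  obtain ⟨b, hb, huniq⟩ := h a ha
  rw [Finset.sum_ite, Finset.sum_const_zero, add_zero, Finset.sum_const, smul_eq_mul, mul_one]
  have : (Finset.univ.filter fun b' : β => P b' a) = {b} := by
    ext b'
    simp only [Finset.mem_filter, Finset.mem_univ, true_and, Finset.mem_singleton]
    exact ⟨fun h' => huniq b' h', fun h' => h' ▸ hb⟩
  rw [this, Finset.card_singleton]

open Classical in
/-- **`Σ_j N_j = #W` on each half of the subdivided edge**: the link-pattern classes partition the XOR space.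
[cite: KhristoforovSmirnov2021, §2 (the three link patterns, arXiv v1 pp. 3–4, Fig. 2) and Definition 3 (p. 4)] -/
theorem sum_card_filter_inClassX {v : HexVertex} (hv : AllSides D v) (i : Fin 3) {s : HexVertex}
    (hs : s ∈ ({v, oppFace v i} : Finset HexVertex)) :
    ∑ j : Fin nm, #((TXb D v i s).filter fun ξ => InClassX D (faceVertex v (i + 1)) (faceVertex v (i + 2)) s j ξ) = #(TXb D v i s) :=
  (card_eq_sum_card_classes' _ _ fun _ hξ => existsUnique_inClassX D hv i hs hξ).symm

end Count

section ThreeMarks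

variable (D : TriMarkedDomain 3)

/-- **`N₁(z) + N₂(z) + N₃(z) = 2 ^ #G`** at every side of a face with three `H_G`-sides. [cite: KhristoforovSmirnov2021, §2 Definition 3 (arXiv v1 p. 4)] -/
theorem sum_classCount_eq {v : HexVertex} (hv : AllSides D v) (i : Fin 3) : ∑ j : Fin 3, classCount D v i j = 2 ^ #D.verts := by
  classical
  unfold classCount
  rw [Finset.sum_add_distrib, sum_card_filter_inClassX D hv i (by simp), sum_card_filter_inClassX D hv i (by simp),
    card_TXb_add_card_TXb D (by decide) hv i]

/-- ★ **`H₁(z) + H₂(z) + H₃(z) = 1`**: Khristoforov–Smirnov's three link-pattern probabilities at a mid-edge sum to one («there are three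
possible link patterns»), at every side of a face with three `H_G`-sides of every 3-marked domain. [cite: KhristoforovSmirnov2021, §2 (the three link patterns, arXiv v1 pp. 3–4, Fig. 2) and Definition 3 (p. 4)] -/
theorem sum_hobs_eq_one {v : HexVertex} (hv : AllSides D v) (i : Fin 3) : ∑ j : Fin 3, Hobs D v i j = 1 := by
  unfold Hobs
  rw [← Finset.sum_div, ← Nat.cast_sum, sum_classCount_eq D hv i]
  push_cast
  exact div_self (pow_ne_zero _ two_ne_zero)

/-- `H_j(z) ≥ 0`. [cite: KhristoforovSmirnov2021, §2 Definition 3 (arXiv v1 p. 4)] -/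
theorem hobs_nonneg (v : HexVertex) (i j : Fin 3) : 0 ≤ Hobs D v i j := by
  unfold Hobs
  positivity

/-- `H_j(z) ≤ 1` at every side of a face with three `H_G`-sides. [cite: KhristoforovSmirnov2021, §2 Definition 3 (arXiv v1 p. 4)] -/
theorem hobs_le_one {v : HexVertex} (hv : AllSides D v) (i j : Fin 3) : Hobs D v i j ≤ 1 := by
  rw [← sum_hobs_eq_one D hv i]
  exact Finset.single_le_sum (fun j' _ => hobs_nonneg D v i j') (Finset.mem_univ j)

/-- **`F(z)` in barycentric form**: `F(z) = H₁·τ⁰… ` — precisely, `F(z) − c = Σ_j H_j(z) (τ^j − c)` for every `c`, since the weights sum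
to one; with `c` inside the triangle this exhibits `F(z)` as a convex combination of `1, τ, τ²`. [cite: KhristoforovSmirnov2021, §2 Definition 3 (arXiv v1 p. 4)] -/
theorem fobs_eq_barycentric {v : HexVertex} (hv : AllSides D v) (i : Fin 3) (c : ℂ) :
    Fobs D v i - c = ∑ j : Fin 3, (Hobs D v i j : ℂ) * (tau ^ (j : ℕ) - c) := by
  have h1 : ∑ j : Fin 3, (Hobs D v i j : ℂ) = 1 := by
    rw [← Complex.ofReal_one, ← sum_hobs_eq_one D hv i, Complex.ofReal_sum]
  unfold Fobs
  simp only [mul_sub, Finset.sum_sub_distrib, ← Finset.sum_mul, h1, one_mul]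
  exact congrArg (· - c) (Finset.sum_congr rfl fun j _ => mul_comm _ _)

end ThreeMarks

end Literature.Probability.Percolation.MarkedLoops
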